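/-
Origin: expansion seat `prover-pub-hodgecm-mc-binder-1-g20-0`, handover #R132 2026-08-21T06:33:11Z md5 9b5e220b6bbb (313 l.; NEW additive KERNEL leaf, ns HodgeCM.CMTypeOps + HodgeCM.Model.LiuCMSide; imports LANDED HodgeCM.Model.Binders.JLiuCornerOfReflex (RUN 62) ONLY; DROP-ALONE chain head (only #R133 imports it); 0 records, 0 `def … : Prop`, nothing cited; §1 `CMTypeOps.isCMField_of_isConj` (Mathlib `IsCMField.of_forall_isConj` WITHOUT the Galois hypothesis, via `IsGaloisGroup.fixedPoints` of `zpowers c`), `conjAut_mem` ∕ `conjRestrict` (complex conjugation of Galois CM `L` restricts to every intermediate field; `isConj_conjRestrict` under every embedding), `isCMField_intermediateField_of_cmType` (an intermediate field of a Galois CM field carrying a CM type is CM); §2 `LiuCMSide.reflexFieldOf_le_fieldRange` («Kʳʳ ⊆ K» from vendored `fixedField_stabilizer_reflexLift_le_fieldRange`), `toCorner : ↥(reflexFieldOf S*) →+* K` with `j ∘ toCorner = incl`; §3 `reflexCMFieldOf` (the reflex field bundled as a `CMField`), `exists_subCorner_of_isReflexOf` ∕ `…OfType_liftType` ∕ `…OfTypeG_liftType`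 = own-htheta #H14 `IsSubCorner C K Ψ (ι₁ ∘ j)` SPELLED OUT (∃ (M' : CMField) (Φ'' : CMType M') e₁ e₂, inflation clauses + σ ∘ e₁ = τ ∘ e₂) for every reflex record of S*(Ψ_L, j), L∕ℚ Galois, NO primitivity ∕ degree, given a CM type on the reflex field with underlying set `reflexTypeC` (#H13 `reflexCMType`, `rfl`); DATA DEFS (not audited): HodgeCM.CMTypeOps.conjRestrictRingEquiv (def, RingEquiv) · HodgeCM.CMTypeOps.conjRestrict (def, AlgEquiv) · HodgeCM.Model.LiuCMSide.reflexLiftSet (abbrev, Set) · HodgeCM.Model.LiuCMSide.toCorner (def, RingHom) · HodgeCM.Model.LiuCMSide.reflexCMFieldOf (abbrev, CMField); NAME LIST: HodgeCM.CMTypeOps.isCMField_of_isConj · HodgeCM.CMTypeOps.conjAut_mem · HodgeCM.CMTypeOps.coe_conjRestrictRingEquiv_apply · HodgeCM.CMTypeOps.coe_conjRestrict_apply · HodgeCM.CMTypeOps.isConj_conjRestrict · HodgeCM.CMTypeOps.not_isReal_of_cmType · HodgeCM.CMTypeOps.isCMField_intermediateField_of_cmType · HodgeCM.Model.LiuCMSide.reflexFieldOf_le_fieldRange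 · HodgeCM.Model.LiuCMSide.coe_mem_fieldRange_of_mem_reflexFieldOf · HodgeCM.Model.LiuCMSide.apply_toCorner · HodgeCM.Model.LiuCMSide.comp_toCorner · HodgeCM.Model.LiuCMSide.exists_subCorner_of_isReflexOf · HodgeCM.Model.LiuCMSide.exists_subCorner_of_isReflexOfType_liftType · HodgeCM.Model.LiuCMSide.exists_subCorner_of_isReflexOfTypeG_liftType) (`HOME/mc/pub-hodgecm-mc-binder-1-g20/stage73/HodgeCM/Model/Binders/JLiuSubCornerOfReflex.lean`, md5 9b5e220b6bbb, 313 lines);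
landed by the gen-31 packager (p-g31) in gate run 73 as `HodgeCM/Model/Binders/JLiuSubCornerOfReflex.lean` (verbatim).
-/
/-
Copyright (c) 2026 the pub-hodgecm formalisation cell (harness21).  New file, not vendored.
Origin: binder-1 lane (unit pub-hodgecm-mc-binder-1-g20, seat prover-pub-hodgecm-mc-binder-1-g20-0), 2026-08-21, as SUPPLIER of the
row-9 owner own-htheta (its `Model/LiuCMSideSubCorner.lean` «NOT HERE» item; routed ask of pub-hodgecm2 own-b01, pub-hodgecm INBOX l.138 (1),
lead 1-g87 STATUS l.15420 ∕ INBOX l.141).  Target in PKG: `HodgeCM/Model/Binders/JLiuSubCornerOfReflex.lean` (NEW additive KERNEL leaf;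
imports the landed `Model/Binders/JLiuCornerOfReflex` (RUN 62) only; nothing imports it; drop alone on bounce).  KERNEL ONLY: theorems +
2 data defs (a restricted automorphism, a bundled `CMField`); no `Prop` minted, nothing cited anew, no new hypothesis kind of E.
Nothing here is a claim of the manuscripts under adjudication.
-/
import Summits.HodgeConjecture.HodgeCM.Model.Binders.JLiuCornerOfReflex

set_option autoImplicit false

/-!
# (J5-subcorner): an admissible reflex record is a SUB-corner of `(K, Ψ, ι₁ ∘ j)` — WITHOUT primitivity

binder-2's `LiuCMSide.isCorner_of_isReflexOf` (`Model/Binders/JLiuCornerOfReflex`) matches the corner `(K, Ψ, ι₁ ∘ j)` with the reflex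
side `C` of the `L`-type `S*(Ψ_L, j)` by an ISOMORPHISM `K ≃ C.K'`, using binder-1's RF1 «the reflex field of `S*(Ψ_L, j)` is `j(K)`»,
which needs `(Ψ_L, j)` PRIMITIVE (true at PerL's sextic scope, `isCorner_of_scope`; FALSE at a face of a Galois sextic, pub-hodgecm2
`Face.psi_exists_eq_inducedCMType` p251194).  Without primitivity one still has ([Streng2010] Ch. I Lemma 7.2 «`Kʳʳ ⊆ K`, `Φ` is induced
by `Φʳʳ`»; [Shimura1998] §8.3 Prop. 28):

* §1 `HodgeCM.CMTypeOps.isCMField_of_isConj` — a number field with an automorphism that is complex conjugation under EVERY complex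
  embedding and is not the identity is a CM field (Mathlib's `NumberField.IsCMField.of_forall_isConj` with the Galois hypothesis
  removed: the order-two group it generates is a Galois group for the extension over its fixed field, `IsGaloisGroup.fixedPoints`);
  `HodgeCM.CMTypeOps.conjRestrict` — complex conjugation of the Galois CM field `L` (central, `conjAut_comm`) RESTRICTS to every
  intermediate field `E ≤ L`, and is complex conjugation under every embedding of `E` (`isConj_conjRestrict`); hence
  **`isCMField_intermediateField_of_cmType`: an intermediate field of a Galois CM field that carries a CM type is a CM field**
  ([Streng2010] Ch. I Lemma 2.2 (d) ∕ [Shimura1998] §8.3 Prop. 28 «`(K*; {ψⱼ})` is a (primitive) CM-type», in the kernel, PKG vocabulary).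
* §2 `HodgeCM.Model.LiuCMSide.reflexFieldOf_le_fieldRange` — «`Kʳʳ ⊆ K`»: `reflexFieldOf (S*(Ψ_L, j)) ≤ j(K)` (vendored
  `fixedField_stabilizer_reflexLift_le_fieldRange`), and the embedding `toCorner : ↥(reflexFieldOf S*) →+* K` with `j ∘ toCorner = incl`.
* §3 **`HodgeCM.Model.LiuCMSide.exists_subCorner_of_isReflexOf`** — for `L/ℚ` Galois, `C` the reflex side of `T := S*(Ψ_L, j)` through `ι₁`,
  and a CM type `Φ'` of the reflex field with underlying set `reflexTypeC ι₁ T` (own-htheta #H13 `reflexCMType` supplies it at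
  `T = autSet ι₁ Φ`): the SUB-CORNER DATA of own-htheta's `LiuCMSide.IsSubCorner C K Ψ (ι₁ ∘ j)` spelled out —
  `∃ (M' : CMField) (Φ'' : CMType M') (e₁ : M' →+* K) (e₂ : M' →+* C.M), (Ψ = Φ''^K along e₁) ∧ (C.ΦA = Φ''^{C.M} along e₂) ∧
  (ι₁ ∘ j) ∘ e₁ = C.τ ∘ e₂` — with `M' :=` the reflex field (a `CMField` by §1), `e₁ := toCorner`, `e₂ := C.k ∘ ε⁻¹`; the type clause is
  «`Φ` is induced by `Φʳʳ`» on embeddings of `K` (vendored `mem_stabilizer_reflexLift_iff` + Mathlib `IntermediateField.fixingSubgroup_fixedField`,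
  extension of embeddings `exists_comp_eq_of_ringHom`, the `Aut(L)`-orbit of `ι₁` `CMTypeOps.exists_eq_comp`); `…_of_isReflexOfType_liftType`,
  `…_of_isReflexOfTypeG_liftType` — the (J4a) ∕ Galois-guarded forms (no `hP`, no degree hypothesis).

KIND: kernel, 0 proof holes, nothing cited anew; expected `#print axioms` ⊆ {propext, Classical.choice, Quot.sound}.
-/

noncomputable section

open scoped Pointwise
open NumberField NumberField.ComplexEmbedding NumberField.InfinitePlace
open Literature.AlgebraicGeometry.Motives (CMType)
open Literature.NumberTheory.ComplexMultiplication

namespace HodgeCM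

/-! ## §1. Restricted complex conjugation; intermediate fields carrying a CM type are CM -/

namespace CMTypeOps

/-- **A number field with an automorphism `c ≠ 1` that is complex conjugation under every complex embedding is a CM field**
(Mathlib `NumberField.IsCMField.of_forall_isConj` without the hypothesis `E/ℚ` Galois: `⟨c⟩ ≅ ℤ/2` is a Galois group for `E` over its
fixed field `E₀`, which is totally real, and `E/E₀` is quadratic). [folklore] -/
theorem isCMField_of_isConj {E : Type} [Field E] [NumberField E] (c : E ≃ₐ[ℚ] E) (h1 : c ≠ 1)
    (hc : ∀ φ : E →+* ℂ, IsConj φ c) : IsCMField E := by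
  haveI : IsTotallyComplex E := ⟨fun w => not_isReal_iff_isComplex.mp fun hw =>
    (isConj_ne_one_iff (hc w.embedding)).mp h1 (isReal_iff.mp hw)⟩
  let φ₀ : E →+* ℂ := Classical.choice (inferInstance : Nonempty _)
  set G : Subgroup (E ≃ₐ[ℚ] E) := Subgroup.zpowers c with hG
  have hcard : Nat.card G = 2 := by
    rw [hG, Nat.card_zpowers, orderOf_isConj_two_of_ne_one (hc φ₀) h1]
  haveI : Finite G := Nat.finite_of_card_ne_zero (by rw [hcard]; decide)
  haveI : FaithfulSMul G E := ⟨fun {g₁ g₂} h => Subtype.ext (AlgEquiv.ext fun x => h x)⟩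
  let F : Subfield E := FixedPoints.subfield G E
  haveI hGal : IsGaloisGroup G F E := IsGaloisGroup.fixedPoints G E
  haveI : IsGalois F E := IsGaloisGroup.isGalois G F E
  haveI : IsTotallyReal F := ⟨fun w => by
    obtain ⟨W, rfl⟩ := w.comap_surjective (K := E)
    dsimp only
    rw [← mk_embedding W, comap_mk, isReal_mk_iff]
    exact ComplexEmbedding.IsConj.isReal_comp
      (σ := IsGaloisGroup.mulEquivAlgEquiv G F E ⟨c, Subgroup.mem_zpowers c⟩) (hc W.embedding)⟩
  haveI : Algebra.IsQuadraticExtension F E := ⟨by rw [← IsGaloisGroup.card_eq_finrank G F E, hcard]⟩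
  exact IsCMField.ofCMExtension F E

variable {L : CMField}

section Restrict

variable [IsGalois ℚ L] (E : IntermediateField ℚ L)

/-- Complex conjugation of the Galois CM field `L` maps every intermediate field into itself (`conjAut L` commutes with `Gal(L/E)`,
`conjAut_comm`, and `E` is the fixed field of `Gal(L/E)`). [folklore] -/
theorem conjAut_mem {x : L} (hx : x ∈ E) : conjAut L x ∈ E := by
  let ι₁ : L →+* ℂ := Classical.choice (inferInstance : Nonempty _)
  have key : conjAut L x ∈ IntermediateField.fixedField E.fixingSubgroup := by
    rw [IntermediateField.mem_fixedField_iff]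
    intro f hf
    have hfx : f x = x := (IntermediateField.mem_fixingSubgroup_iff _ _).1 hf x hx
    have h := conjAut_comm ι₁ f.toRingEquiv x
    rw [AlgEquiv.coe_ringEquiv, hfx] at h
    exact h.symm
  rwa [IsGalois.fixedField_fixingSubgroup] at key

/-- Complex conjugation of `L` restricted to the intermediate field `E`, as a ring automorphism of `E`. [folklore] -/
def conjRestrictRingEquiv : ↥E ≃+* ↥E where
  toFun x := ⟨conjAut L x, conjAut_mem E x.2⟩
  invFun x := ⟨conjAut L x, conjAut_mem E x.2⟩
  left_inv x := Subtype.ext (conjAut_conjAut (x : L))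
  right_inv x := Subtype.ext (conjAut_conjAut (x : L))
  map_mul' x y := Subtype.ext (map_mul (conjAut L) (x : L) y)
  map_add' x y := Subtype.ext (map_add (conjAut L) (x : L) y)

/-- (Ported verbatim from the HodgeCMPerL package; no docstring in the source.) -/
@[simp] theorem coe_conjRestrictRingEquiv_apply (x : ↥E) : ((conjRestrictRingEquiv E x : ↥E) : L) = conjAut L x := rfl

/-- **Complex conjugation of `L` restricted to `E`**, as a `ℚ`-algebra automorphism of `E` ([Streng2010] Ch. I Lemma 2.2 (d): «`¯` restricts
to an automorphism of `K`»). [folklore] -/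
def conjRestrict : ↥E ≃ₐ[ℚ] ↥E :=
  AlgEquiv.ofRingEquiv (f := conjRestrictRingEquiv E) fun r => Subtype.ext (by simp)

/-- (Ported verbatim from the HodgeCMPerL package; no docstring in the source.) -/
@[simp] theorem coe_conjRestrict_apply (x : ↥E) : ((conjRestrict E x : ↥E) : L) = conjAut L x := rfl

/-- `conjRestrict E` is complex conjugation under EVERY complex embedding of `E` («every embedding `K → ℂ` extends to an embedding `L → ℂ`»,
[Streng2010] Ch. I Lemma 2.2 (d)). [folklore] -/
theorem isConj_conjRestrict (φ : ↥E →+* ℂ) : IsConj φ (conjRestrict E) := by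
  obtain ⟨τ, hτ⟩ := Model.exists_comp_eq_of_ringHom (algebraMap (↥E) L) φ
  refine RingHom.ext fun x => ?_
  have hx : φ x = τ (x : L) := by rw [← hτ]; rfl
  have hcx : φ (conjRestrict E x) = τ (conjAut L x) := by rw [← hτ]; rfl
  change starRingEnd ℂ (φ x) = φ (conjRestrict E x)
  rw [hcx, apply_conjAut, hx]

/-- A field carrying a «CM type» (a set of complex embeddings containing exactly one of each conjugate pair) has no real embedding. [folklore] -/
theorem not_isReal_of_cmType {E : Type} [Field E] (Φ' : Set (E →+* ℂ)) (hΦ' : ∀ φ, φ ∈ Φ' ↔ conjugate φ ∉ Φ')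
    (φ : E →+* ℂ) : ¬ ComplexEmbedding.IsReal φ := by
  intro hφ
  have h := hΦ' φ
  rw [show conjugate φ = φ from hφ] at h
  exact iff_not_self h

/-- **An intermediate field of a Galois CM field that carries a CM type is a CM field** ([Streng2010] Ch. I Lemma 2.2 (d) «any subfield of a
CM-field is totally real or a CM-field»; [Shimura1998] §8.3 Prop. 28 for the reflex field). [folklore] -/
theorem isCMField_intermediateField_of_cmType (Φ' : Set (↥E →+* ℂ)) (hΦ' : ∀ φ, φ ∈ Φ' ↔ conjugate φ ∉ Φ') : IsCMField ↥E := by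
  let φ₀ : ↥E →+* ℂ := Classical.choice (inferInstance : Nonempty _)
  refine isCMField_of_isConj (conjRestrict E) ?_ (isConj_conjRestrict E)
  intro h1
  have hreal : ComplexEmbedding.IsReal φ₀ := isConj_one_iff.mp (h1 ▸ isConj_conjRestrict E φ₀)
  exact not_isReal_of_cmType Φ' hΦ' φ₀ hreal

end Restrict

end CMTypeOps

/-! ## §2. «`Kʳʳ ⊆ K`»: the reflex field of `S*(Ψ_L, j)` lies in `j(K)` -/

namespace Model

namespace LiuCMSide

open HodgeCM.SignRecipe (pullbackTypeAlg)

variable {L : CMField} {ι₁ : L →+* ℂ}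

/-- The `L`-type `S*(Ψ_L, j) = reflexLift Ψ_L j ⊆ Aut_ℚ(L)` of the corner `(K, Ψ)` embedded by `j` (= `autSet ι₁ (liftType false K L j ι₁ Ψ)`,
`autSet_liftType_false`). [folklore] -/
abbrev reflexLiftSet (ι₁ : L →+* ℂ) {K : CMField} (Ψ : CMType K) (j : K →+* L) : Set (L ≃ₐ[ℚ] L) :=
  (reflexLift (pullbackTypeAlg ι₁ Ψ) j.toRatAlgHom : Set (L ≃ₐ[ℚ] L))

/-- **«`Kʳʳ ⊆ K`»** ([Streng2010] Ch. I Lemma 7.2): for `L/ℚ` Galois the reflex field of the `L`-type `S*(Ψ_L, j)` lies in `j(K)` — no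
primitivity needed (with it, equality: binder-1 RF1 `reflexField_liftTypeSet_eq_fieldRange`). [folklore] -/
theorem reflexFieldOf_le_fieldRange [IsGalois ℚ L] {K : CMField} (Ψ : CMType K) (j : K →+* L) :
    reflexFieldOf (reflexLiftSet ι₁ Ψ j) ≤ (j.toRatAlgHom : K →ₐ[ℚ] L).fieldRange := by
  show reflexField ℚ L (autImage (reflexLiftSet ι₁ Ψ j)) ≤ _
  rw [reflexField_eq_fixedField, SignRecipe.stabilizer_image_coe_eq]
  exact fixedField_stabilizer_reflexLift_le_fieldRange (pullbackTypeAlg ι₁ Ψ) j.toRatAlgHom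

/-- Every element of the reflex field of `S*(Ψ_L, j)` is in the range of `j`. [folklore] -/
theorem coe_mem_fieldRange_of_mem_reflexFieldOf [IsGalois ℚ L] {K : CMField} (Ψ : CMType K) (j : K →+* L)
    (y : ↥(reflexFieldOf (reflexLiftSet ι₁ Ψ j))) : (y : L) ∈ j.fieldRange := by
  have hy := reflexFieldOf_le_fieldRange (ι₁ := ι₁) Ψ j y.2
  rw [AlgHom.mem_fieldRange] at hy
  obtain ⟨x, hx⟩ := hy
  exact RingHom.mem_fieldRange.2 ⟨x, hx⟩

/-- **The embedding of the reflex field of `S*(Ψ_L, j)` into the corner field `K`** (`j⁻¹` on `j(K) ⊇ Kʳʳ`). [folklore] -/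
def toCorner [IsGalois ℚ L] {K : CMField} (Ψ : CMType K) (j : K →+* L) :
    ↥(reflexFieldOf (reflexLiftSet ι₁ Ψ j)) →+* K :=
  j.rangeRestrictFieldEquiv.symm.toRingHom.comp
    ((algebraMap (↥(reflexFieldOf (reflexLiftSet ι₁ Ψ j))) L).codRestrict j.fieldRange
      (coe_mem_fieldRange_of_mem_reflexFieldOf Ψ j))

/-- (Ported verbatim from the HodgeCMPerL package; no docstring in the source.) -/
@[simp] theorem apply_toCorner [IsGalois ℚ L] {K : CMField} (Ψ : CMType K) (j : K →+* L)
    (y : ↥(reflexFieldOf (reflexLiftSet ι₁ Ψ j))) : j (toCorner (ι₁ := ι₁) Ψ j y) = (y : L) := by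
  show j (j.rangeRestrictFieldEquiv.symm _) = _
  rw [RingHom.rangeRestrictFieldEquiv_apply_symm_apply]
  rfl

/-- (Ported verbatim from the HodgeCMPerL package; no docstring in the source.) -/
theorem comp_toCorner [IsGalois ℚ L] {K : CMField} (Ψ : CMType K) (j : K →+* L) :
    j.comp (toCorner (ι₁ := ι₁) Ψ j) = algebraMap (↥(reflexFieldOf (reflexLiftSet ι₁ Ψ j))) L :=
  RingHom.ext fun y => apply_toCorner Ψ j y

/-! ## §3. The sub-corner data of a reflex record, without primitivity -/

/-- **The reflex field of `S*(Ψ_L, j)` as a bundled CM field**, given a CM type `Φ'` on it (§1: an intermediate field of the Galois CM field `L`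
carrying a CM type is CM). [folklore] -/
abbrev reflexCMFieldOf [IsGalois ℚ L] (T : Set (L ≃ₐ[ℚ] L)) (Φ' : CMType ↥(reflexFieldOf T)) : CMField :=
  @CMField.mk ↥(reflexFieldOf T) _ _ (CMTypeOps.isCMField_intermediateField_of_cmType (reflexFieldOf T) Φ'.1 Φ'.2)

/-- **(J5-subcorner) — an admissible reflex record is a SUB-corner of `(K, Ψ, ι₁ ∘ j)`, WITHOUT primitivity.**  For `L/ℚ` Galois, `C` the
reflex side of `T := S*(Ψ_L, j)` read through `ι₁` (`ε : C.K' ≃ Kʳʳ := reflexFieldOf T`, `C.τ ∘ C.k = ι₁ ∘ incl ∘ ε`, `C.Φ' ↔ reflexTypeC ι₁ T`),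
and `Φ'` a CM type of `Kʳʳ` with underlying set `reflexTypeC ι₁ T`: the data of own-htheta's `LiuCMSide.IsSubCorner C K Ψ (ι₁ ∘ j)` —
`M' := Kʳʳ` (a CM field), `Φ'' := Φ'`, `e₁ := toCorner` (`j ∘ e₁ = incl`), `e₂ := C.k ∘ ε⁻¹`; clause 1 is «`Φ` is induced by `Φʳʳ`» read on
embeddings of `K` ([Streng2010] Ch. I Lemma 7.2), clause 2 is `C.hΦA` transported along `ε`, clause 3 is `C.τ ∘ C.k = ι₁ ∘ incl ∘ ε`. [folklore] -/
theorem exists_subCorner_of_isReflexOf [IsGalois ℚ L] (C : LiuCMSide) {K : CMField} (Ψ : CMType K) (j : K →+* L)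
    (Φ' : CMType ↥(reflexFieldOf (reflexLiftSet ι₁ Ψ j)))
    (hΦ' : Φ'.1 = reflexTypeC ι₁ (reflexLiftSet ι₁ Ψ j))
    (h : C.IsReflexOf ι₁ (reflexLiftSet ι₁ Ψ j)) :
    ∃ (M' : CMField) (Φ'' : CMType M') (e₁ : M' →+* K) (e₂ : M' →+* C.M),
      (∀ τ : K →+* ℂ, τ ∈ Ψ.1 ↔ τ.comp e₁ ∈ Φ''.1) ∧ (∀ θ : C.M →+* ℂ, θ ∈ C.ΦA.1 ↔ θ.comp e₂ ∈ Φ''.1) ∧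
        (ι₁.comp j).comp e₁ = C.τ.comp e₂ := by
  obtain ⟨ε, hτ, hΦ⟩ := h
  -- the lifted reflex type of `T = S*` with base point `id` is `S`
  have hS : (reflexLift (autImage (reflexLiftSet ι₁ Ψ j)) (AlgHom.id ℚ L) : Set (L ≃ₐ[ℚ] L)) =
      typeLift (pullbackTypeAlg ι₁ Ψ) j.toRatAlgHom :=
    SignRecipe.reflexLift_image_reflexLift_id_eq_typeLift (pullbackTypeAlg ι₁ Ψ) j.toRatAlgHom
  -- `Gal(L/Kʳʳ) = H'` = the (left) stabiliser of `S*`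
  have hfix : (reflexFieldOf (reflexLiftSet ι₁ Ψ j)).fixingSubgroup =
      MulAction.stabilizer (L ≃ₐ[ℚ] L) (reflexLiftSet ι₁ Ψ j) := by
    show (reflexField ℚ L (autImage (reflexLiftSet ι₁ Ψ j))).fixingSubgroup = _
    rw [reflexField_eq_fixedField, IntermediateField.fixingSubgroup_fixedField, SignRecipe.stabilizer_image_coe_eq]
  have hje₁ : ∀ y : ↥(reflexFieldOf (reflexLiftSet ι₁ Ψ j)), j (toCorner (ι₁ := ι₁) Ψ j y) = (y : L) :=
    fun y => apply_toCorner Ψ j y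
  refine ⟨reflexCMFieldOf (reflexLiftSet ι₁ Ψ j) Φ', Φ', toCorner (ι₁ := ι₁) Ψ j, C.k.comp ε.symm.toRingHom,
    fun τ => ?_, fun θ => ?_, ?_⟩
  · -- clause 1: `τ ∈ Ψ ↔ τ ∘ e₁ ∈ Φ'` — «`Φ` is induced by `Φʳʳ`»
    -- write an extension of `τ` to `L` as `ι₁ ∘ g`
    obtain ⟨τ', hτ'⟩ := exists_comp_eq_of_ringHom j τ
    obtain ⟨g₀, hg₀⟩ := CMTypeOps.exists_eq_comp (L := L) inferInstance ι₁ τ'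
    let g : L ≃ₐ[ℚ] L := AlgEquiv.ofRingEquiv (f := g₀) fun r => by simp
    have hgτ : ι₁.comp ((g • (j.toRatAlgHom : K →ₐ[ℚ] L)).toRingHom) = τ := by
      rw [← hτ', hg₀]; ext x; rfl
    -- `g ∈ S ↔ τ ∈ Ψ`
    have hgS : g ∈ typeLift (pullbackTypeAlg ι₁ Ψ) j.toRatAlgHom ↔ τ ∈ Ψ.1 := by
      rw [mem_typeLift, SignRecipe.mem_pullbackTypeAlg_iff, hgτ]
    -- `τ ∘ e₁ = ι₁ ∘ g ∘ incl`
    have hτe : τ.comp (toCorner (ι₁ := ι₁) Ψ j) =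
        (ι₁.comp (g : L →+* L)).comp (algebraMap (↥(reflexFieldOf (reflexLiftSet ι₁ Ψ j))) L) := by
      refine RingHom.ext fun y => ?_
      have h1 : τ (toCorner (ι₁ := ι₁) Ψ j y) = τ' (j (toCorner (ι₁ := ι₁) Ψ j y)) := by rw [← hτ']; rfl
      rw [RingHom.comp_apply, h1, hje₁, hg₀]
      rfl
    rw [show Φ'.1 = reflexTypeC ι₁ (reflexLiftSet ι₁ Ψ j) from hΦ']
    constructor
    · intro hτΨ
      refine ⟨g, ?_, hτe⟩
      rw [hS]
      exact hgS.2 hτΨ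
    · rintro ⟨g', hg', hge⟩
      rw [hS] at hg'
      -- `g` and `g'` agree on `Kʳʳ`, so `u := g'⁻¹ * g ∈ Gal(L/Kʳʳ) = H'`
      have hagree : ∀ y : L, y ∈ reflexFieldOf (reflexLiftSet ι₁ Ψ j) → g y = g' y := fun y hy => by
        have hy' := RingHom.congr_fun (hτe.symm.trans hge) ⟨y, hy⟩
        exact ι₁.injective hy'
      have hu : g'⁻¹ * g ∈ MulAction.stabilizer (L ≃ₐ[ℚ] L) (reflexLiftSet ι₁ Ψ j) := by
        rw [← hfix, IntermediateField.mem_fixingSubgroup_iff]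
        intro y hy
        rw [AlgEquiv.mul_apply, hagree y hy, ← AlgEquiv.mul_apply, inv_mul_cancel, AlgEquiv.one_apply]
      -- `H'` is the right stabiliser of `S`: `g' ∈ S ⇒ g' * u = g ∈ S`
      have hgS' : g ∈ typeLift (pullbackTypeAlg ι₁ Ψ) j.toRatAlgHom := by
        have := ((mem_stabilizer_reflexLift_iff (pullbackTypeAlg ι₁ Ψ) j.toRatAlgHom (g'⁻¹ * g)).1 hu g').2 hg'
        rwa [mul_inv_cancel_left] at this
      exact hgS.1 hgS'
  · -- clause 2: `C.ΦA = Φ'^{C.M}` along `e₂ = k ∘ ε⁻¹`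
    rw [C.hΦA θ, hΦ (θ.comp C.k), show Φ'.1 = reflexTypeC ι₁ (reflexLiftSet ι₁ Ψ j) from hΦ']
    exact Iff.rfl
  · -- clause 3: `(ι₁ ∘ j) ∘ e₁ = ι₁ ∘ incl = (C.τ ∘ C.k) ∘ ε⁻¹`
    refine RingHom.ext fun y => ?_
    change ι₁ (j (toCorner (ι₁ := ι₁) Ψ j y)) = (C.τ.comp C.k) (ε.symm y)
    rw [hje₁, hτ]
    simp only [RingHom.comp_apply, RingEquiv.toRingHom_eq_coe, RingEquiv.coe_toRingHom, RingEquiv.apply_symm_apply]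
    rfl

/-- **(J5-subcorner), `CMType` form**: for `L/ℚ` Galois and `C` the reflex side of the (J4a) type `liftType false K L j ι₁ Ψ` (= `Φ_μ` of the
theta classes of the corner), the sub-corner data of `(K, Ψ, ι₁ ∘ j)` — no primitivity, no degree hypothesis.  The CM type `Φ'` of the reflex
field is own-htheta's `reflexCMType ι₁ (liftType false K L j ι₁ Ψ)` (#H13, `rfl` on the underlying set). [folklore] -/
theorem exists_subCorner_of_isReflexOfType_liftType [IsGalois ℚ L] (C : LiuCMSide) {K : CMField} (Ψ : CMType K) (j : K →+* L)
    (Φ' : CMType ↥(reflexFieldOf (autSet ι₁ (SignRecipe.liftType false K L j ι₁ Ψ))))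
    (hΦ' : Φ'.1 = reflexTypeC ι₁ (autSet ι₁ (SignRecipe.liftType false K L j ι₁ Ψ)))
    (h : C.IsReflexOfType ι₁ (SignRecipe.liftType false K L j ι₁ Ψ)) :
    ∃ (M' : CMField) (Φ'' : CMType M') (e₁ : M' →+* K) (e₂ : M' →+* C.M),
      (∀ τ : K →+* ℂ, τ ∈ Ψ.1 ↔ τ.comp e₁ ∈ Φ''.1) ∧ (∀ θ : C.M →+* ℂ, θ ∈ C.ΦA.1 ↔ θ.comp e₂ ∈ Φ''.1) ∧
        (ι₁.comp j).comp e₁ = C.τ.comp e₂ := by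
  have hT := autSet_liftType_false ι₁ j Ψ
  unfold IsReflexOfType at h
  revert Φ' hΦ' h
  rw [hT]
  intro Φ' hΦ' h
  exact exists_subCorner_of_isReflexOf C Ψ j Φ' hΦ' h

/-- (J5-subcorner) for the Galois-guarded admissibility predicate `IsReflexOfTypeG` (the `adm μ d` of the dictionary): at `L/ℚ` Galois the
guard is discharged. [folklore] -/
theorem exists_subCorner_of_isReflexOfTypeG_liftType [hG : IsGalois ℚ L] (C : LiuCMSide) {K : CMField} (Ψ : CMType K) (j : K →+* L)
    (Φ' : CMType ↥(reflexFieldOf (autSet ι₁ (SignRecipe.liftType false K L j ι₁ Ψ))))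
    (hΦ' : Φ'.1 = reflexTypeC ι₁ (autSet ι₁ (SignRecipe.liftType false K L j ι₁ Ψ)))
    (h : C.IsReflexOfTypeG ι₁ (SignRecipe.liftType false K L j ι₁ Ψ)) :
    ∃ (M' : CMField) (Φ'' : CMType M') (e₁ : M' →+* K) (e₂ : M' →+* C.M),
      (∀ τ : K →+* ℂ, τ ∈ Ψ.1 ↔ τ.comp e₁ ∈ Φ''.1) ∧ (∀ θ : C.M →+* ℂ, θ ∈ C.ΦA.1 ↔ θ.comp e₂ ∈ Φ''.1) ∧
        (ι₁.comp j).comp e₁ = C.τ.comp e₂ :=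
  exists_subCorner_of_isReflexOfType_liftType C Ψ j Φ' hΦ' (h hG)

end LiuCMSide

end Model

end HodgeCM

end
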